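import Mathlib
import HarnessLib
import Summits.NavierStokesRegularity.NavierStokesRegularity.Theorems.QuarterLogPincerFlatChainDefs
import Summits.NavierStokesRegularity.NavierStokesRegularity.Theorems.QuarterLogPincerCubicRungDefs
import Summits.NavierStokesRegularity.NavierStokesRegularity.Theorems.QuarterLogPincerFlatChainAssembly
import Summits.NavierStokesRegularity.NavierStokesRegularity.Theorems.TypeIQuantSubcubicExp.Negative.SliceCensusThreshold

/-!
# The census node of LINE g14-2 (`slice_census`) is EXACTLY the rung — Negative lane, BY NAME

Refuter file (ns-afl-r1 g13) supporting `stmt-NavierStokesRegularity-24077`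
(`Summit.NavierStokesRegularity.NavierStokesRegularity.Theses.QuarterLogPincer.TypeIQuantSubcubicExp`, OPEN).
No Theses declaration is asserted here; theorem-only; standard axioms.

Over the ported objects of LINE `flat_chain` (`Theorems/QuarterLogPincerFlatChainDefs.lean`,
`…FlatChainAssembly.lean`, typer g39) and the W7 rung `CubicRung.TypeIQuantCubicExp`
(`Theorems/QuarterLogPincerCubicRungDefs.lean`):

* `sliceCensus_of_typeIQuantCubicExp : TypeIQuantCubicExp → SliceCensus` — the rung implies the slice census at
  EVERY separation `a > 0` (`a₀ := 1`), because a violator of `n` levels forces `a(n+1) ≤ K⁺A³`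
  (`SliceCensusThreshold.sliceCensusAt_of_quantCubicExpAt`, p722861);
* `sliceCensus_iff_typeIQuantCubicExp : LightSliceRegular → LevelConcentration → (SliceCensus ↔ TypeIQuantCubicExp)` —
  with β and S1 (S1 is sorry-free in the Cruxes workfile v1.12; β open) the census node and the rung are EQUIVALENT:
  the line re-routes R0 faithfully but cannot lower its debt below R0 itself.  The forward direction is the tree's
  `FlatChain.typeIQuantCubicExp_of_sliceCensus_of_lightSlice` (p723699).

HONEST LABEL: facts about the line's own objects.  `SliceCensus`, `TypeIQuantCubicExp` (R0), ⟨24077⟩, W7 and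
NS regularity are OPEN — nothing here proves or refutes them.
-/

set_option linter.dupNamespace false

noncomputable section

namespace Summit.NavierStokesRegularity.NavierStokesRegularity.Theorems.TypeIQuantSubcubicExp.Negative.SliceCensusIsRung

open Summit.NavierStokesRegularity.NavierStokesRegularity.Cruxes.TypeIQuantSubcubicExp.FlatChain
open Summit.NavierStokesRegularity.NavierStokesRegularity.Cruxes.TypeIQuantSubcubicExp.CubicRung
open Summit.NavierStokesRegularity.NavierStokesRegularity.Theorems.TypeIQuantSubcubicExp.Negative.SliceCensusThreshold

/-- **The rung implies the slice census** (every `M, γ, ϑ, Λ`; `a₀ := 1`). -/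
theorem sliceCensus_of_typeIQuantCubicExp (h : TypeIQuantCubicExp) : SliceCensus := by
  intro M γ ϑ Λ _hM _hγ _hϑ _hΛ
  refine ⟨1, fun a ha => ?_⟩
  exact sliceCensusAt_of_quantCubicExpAt (lt_of_lt_of_le one_pos ha) (h M)

/-- **Given β and S1, the census node of LINE g14-2 IS the rung.** -/
theorem sliceCensus_iff_typeIQuantCubicExp (hβ : LightSliceRegular) (hconc : LevelConcentration) :
    SliceCensus ↔ TypeIQuantCubicExp :=
  ⟨fun hcen => typeIQuantCubicExp_of_sliceCensus_of_lightSlice hcen hβ hconc, sliceCensus_of_typeIQuantCubicExp⟩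

end Summit.NavierStokesRegularity.NavierStokesRegularity.Theorems.TypeIQuantSubcubicExp.Negative.SliceCensusIsRung

end
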